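import Literature.AlgebraicGeometry.Motives.AlgPointsFiniteFibres
import Literature.AlgebraicGeometry.Resolution.AlterationsDimension
import HarnessLib

/-!
# Alterations onto the image: a proper morphism with finite general fibres, lifted to its (reduced) image

Layer `Literature/AlgebraicGeometry/Motives` (namespaces `….Morphisms` for the scheme-level statements, `….Motives.AlgPoints`
for the `k`-point currency).  KERNEL ONLY (theorems; no definition, no named fact, no instance, no `sorry`).  Companion of ★
`Motives/AlgPointsFiniteFibres` (`AlgPoints.isAlteration_left_of_finite_nonempty_fibres`: proper + finite non-empty `k`-point
fibres over a non-empty open of an IRREDUCIBLE TARGET ⇒ alteration) and of ★ `Morphisms/EtaleLocusFibres` §3.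

In practice the target of a generically finite proper morphism `ψ : T → S` (`T` integral) is not irreducible and `ψ` is not
dominant: one first replaces `S` by a closed irreducible `Z ⊇ ψ(T)` — typically the image `ψ(T)` itself, closed because `ψ` is
proper and irreducible because `T` is — with its REDUCED INDUCED closed-subscheme structure (Hartshorne II Example 3.2.6; Mathlib
`(vanishingIdeal Z).subscheme`), through which `ψ` factors because `T` is reduced (Hartshorne II Ex. 3.11 (d): the
scheme-theoretic image of a reduced scheme is the reduced structure on the closure of the image; Mathlib `map_vanishingIdeal` +
`IsClosedImmersion.lift`).  This file packages that step once, so that consumers state finiteness of fibres over `S` and receive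
an alteration onto `Z` (de Jong 1996, 2.20) together with the dimension identity `dim Z = dim T`:

* §1 (schemes; `S` Jacobson) `Morphisms.ker_subschemeι_vanishingIdeal_le_ker_of_range_subset` (the factorisation inequality
  `ker ι_Z ≤ ker ψ` for `T` reduced and `ψ(T) ⊆ Z`),
  **`Morphisms.exists_isAlteration_lift_of_finite_nonempty_preimage_of_isClosed`** — `ψ : T → S` proper, `T` integral,
  `Z ⊇ ψ(T)` closed irreducible, and over the closed points of `V ∩ Z` (`V ⊆ S` open, `V ∩ Z ≠ ∅`) the fibres of `ψ` are finite and
  non-empty ⇒ `∃ φ : T → Z_red`, `φ ≫ ι_Z = ψ`, `φ` an alteration; **`…_lift_range_…`** — the IMAGE edition `Z := ψ(T)`, where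
  irreducibility and non-emptiness of the fibres are automatic;
* §2 (schemes locally of finite type over a field `k`) `Morphisms.topologicalKrullDim_coe_eq_of_isAlteration_lift` and the two
  combined heads **`topologicalKrullDim_coe_eq_of_finite_nonempty_preimage_of_isClosed`** ∕ **`topologicalKrullDim_range_eq_of_…`**:
  `dim Z = dim T`, resp. `dim ψ(T) = dim T` (★ de Jong 2.20 `IsAlteration.topologicalKrullDim_eq` + `Z_red ≃ₜ Z`);
* §3 (`k` algebraically closed, `X`, `Y` locally of finite type over `k`; the `k`-POINT currency of ★ `AlgPoints*`)
  `AlgPoints.exists_map_eq_of_pt_mem_range` (a `k`-point of `Y` in the image of `α : X → Y` is the image of a `k`-point of `X` —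
  Nullstellensatz), **`AlgPoints.exists_isAlteration_lift_of_finite_nonempty_fibres`** ∕ **`…_lift_range_of_finite_fibres`** and
  **`AlgPoints.topologicalKrullDim_coe_eq_of_finite_nonempty_fibres`** ∕ **`AlgPoints.topologicalKrullDim_range_eq_of_finite_fibres`**
  — the same statements with «finitely many (resp. some) `k`-points of `X` over the `k`-point `a`» as the fibre hypotheses.

Use (cell `hodgecm-mathlib`, D-0151; crux HLiu418 = stmt-HodgeConjecture-24832): the block «lift through the reduced structure on
`W̃_r(P)` + instances + fibre dictionary» is written out twice by hand in ★ `Motives/JacobianPrimeThetaDivisorExists`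
(`Jacobian.exists_isAlteration_lift_abelSum`) and ★ `Motives/JacobianBrillNoetherLocusDimensionLe`
(`Jacobian.exists_isAlteration_lift_abelSum_of_add`, Lange Lemma 4.2.1 (ii)); the heads here are the general form for the
`r`-general Brill–Noether shapes and for any incidence correspondence with known finite general fibres.  COUNT-NEUTRAL capital.
HC_CM is proved only modulo the 7 printed citations until rung 0 closes; this file moves no book by itself.

## References
* [DeJong1996] A. J. de Jong, *Smoothness, semi-stability and alterations*, Publ. Math. IHÉS 83 (1996), 2.20, p. 61 (alterations;
  «equivalent to `dim S = dim S′`»).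
* [Hartshorne1977] R. Hartshorne, *Algebraic Geometry* (1977), II Example 3.2.6 (reduced induced closed subscheme), II Ex. 3.11 (d)
  (scheme-theoretic image of a reduced scheme), II Ex. 2.7 and Ex. 3.14 (rational points; closed points of schemes of finite type
  over a field).
* [GortzWedhorn2020] U. Görtz, T. Wedhorn, *Algebraic Geometry I*, 2nd ed., Prop. 3.35 and Section (3.13) (closed points of
  `k`-schemes locally of finite type are very dense; Jacobson schemes).
-/

set_option autoImplicit false

noncomputable section

universe u

open CategoryTheory AlgebraicGeometry TopologicalSpace Topology

namespace Literature.AlgebraicGeometry.Morphisms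

open Scheme.IdealSheafData Literature.AlgebraicGeometry.Resolution

variable {T S : Scheme.{u}} (ψ : T ⟶ S)

/-! ## §1 The lift of a proper, generically finite morphism to its reduced image is an alteration -/

section Lift

/-- **A morphism from a REDUCED scheme factors (set-theoretically ⇒ scheme-theoretically) through the reduced closed subscheme
on any closed `Z` containing its image**: `ker ι_Z ≤ ker ψ`, the inequality consumed by Mathlib's `IsClosedImmersion.lift` — the
scheme-theoretic image of a reduced scheme is the reduced induced structure on the closure of its image (Mathlib
`map_vanishingIdeal` at the nilradical `⊥`). [cite: Hartshorne1977, II Ex. 3.11 (d) and Example 3.2.6] -/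
theorem ker_subschemeι_vanishingIdeal_le_ker_of_range_subset [IsReduced T] (Z : Closeds S)
    (hψZ : Set.range ψ.base ⊆ (Z : Set S)) : (vanishingIdeal Z).subschemeι.ker ≤ ψ.ker := by
  have hker : ψ.ker = vanishingIdeal (Closeds.closure (Set.range ψ.base)) := by
    rw [← map_bot, ← Scheme.nilradical_eq_bot, ← vanishingIdeal_top, map_vanishingIdeal, Closeds.coe_top,
      Set.image_univ]
  rw [ker_subschemeι, hker]
  exact vanishingIdeal_antimono (Closeds.closure_le.2 hψZ)

/-- The fibres of the lift `φ` of `ψ` through a closed immersion `ι` (`φ ≫ ι = ψ`) are fibres of `ψ`: `φ⁻¹(w) = ψ⁻¹(ι w)`.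
[folklore] -/
private theorem preimage_singleton_eq_of_comp_eq {W : Scheme.{u}} (ι : W ⟶ S) [IsClosedImmersion ι] (φ : T ⟶ W)
    (hφ : φ ≫ ι = ψ) (w : W) : φ.base ⁻¹' {w} = ψ.base ⁻¹' {ι.base w} := by
  have hc : ∀ t : T, ψ.base t = ι.base (φ.base t) := fun t => by rw [← hφ]; rfl
  ext t
  simp only [Set.mem_preimage, Set.mem_singleton_iff]
  constructor
  · intro h
    rw [hc, h]
  · intro h
    exact ι.isClosedEmbedding.injective ((hc t).symm.trans h)

/-- **A proper morphism with finite non-empty general fibres, lifted to a closed irreducible `Z` containing its image, is an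
ALTERATION onto `Z`.**  Let `ψ : T → S` be proper with `T` integral and `S` Jacobson, `Z ⊆ S` closed and irreducible with
`ψ(T) ⊆ Z`, and `V ⊆ S` open with `V ∩ Z ≠ ∅` such that over every closed point of `V ∩ Z` the fibre of `ψ` is finite and
non-empty.  Then `ψ` factors as `φ ≫ ι_Z` through the reduced closed subscheme `Z_red` on `Z`, and `φ : T → Z_red` is an
alteration (★ `Resolution.IsAlteration`: integral source, proper, dominant, finite over a non-empty open), by ★
`isAlteration_of_finite_nonempty_preimage_of_isClosed` applied on `Z_red` (integral: ★ `isIntegral_subscheme_vanishingIdeal`;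
Jacobson as a closed subspace; `φ` proper as `ι_Z` is separated; `φ⁻¹(w) = ψ⁻¹(w)`).
[cite: DeJong1996, 2.20, p. 61] [cite: Hartshorne1977, II Example 3.2.6 and Ex. 3.11 (d)] -/
theorem exists_isAlteration_lift_of_finite_nonempty_preimage_of_isClosed [IsIntegral T] [IsProper ψ]
    [JacobsonSpace S] (Z : Closeds S) (hZ : IsIrreducible (Z : Set S)) (hψZ : Set.range ψ.base ⊆ (Z : Set S))
    (V : S.Opens) (hV : ((V : Set S) ∩ Z).Nonempty)
    (hfin : ∀ s : S, s ∈ V → s ∈ (Z : Set S) → IsClosed ({s} : Set S) → (ψ.base ⁻¹' {s}).Finite)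
    (hne : ∀ s : S, s ∈ V → s ∈ (Z : Set S) → IsClosed ({s} : Set S) → (ψ.base ⁻¹' {s}).Nonempty) :
    ∃ φ : T ⟶ (vanishingIdeal Z).subscheme,
      φ ≫ (vanishingIdeal Z).subschemeι = ψ ∧ IsAlteration φ := by
  set I := vanishingIdeal Z with hI
  have hker : I.subschemeι.ker ≤ ψ.ker := ker_subschemeι_vanishingIdeal_le_ker_of_range_subset ψ Z hψZ
  let φ : T ⟶ I.subscheme := IsClosedImmersion.lift I.subschemeι ψ hker
  have hφ : φ ≫ I.subschemeι = ψ := IsClosedImmersion.lift_fac _ _ _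
  refine ⟨φ, hφ, ?_⟩
  -- instances on `Z_red` and on `φ`
  haveI : IsIntegral I.subscheme := isIntegral_subscheme_vanishingIdeal Z hZ
  haveI : IsProper (φ ≫ I.subschemeι) := by rw [hφ]; infer_instance
  haveI : IsProper φ := IsProper.of_comp φ I.subschemeι
  haveI : JacobsonSpace I.subscheme := JacobsonSpace.of_isClosedEmbedding I.subschemeι.isClosedEmbedding
  have hrange : Set.range I.subschemeι.base = (Z : Set S) := range_subschemeι_vanishingIdeal Z
  have hwZ : ∀ w : I.subscheme, I.subschemeι.base w ∈ (Z : Set S) := fun w => hrange ▸ ⟨w, rfl⟩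
  have hcl : ∀ w : I.subscheme, IsClosed ({w} : Set I.subscheme) →
      IsClosed ({I.subschemeι.base w} : Set S) := by
    intro w hw
    simpa only [Set.image_singleton] using I.subschemeι.isClosedEmbedding.isClosedMap _ hw
  refine isAlteration_of_finite_nonempty_preimage_of_isClosed φ (I.subschemeι ⁻¹ᵁ V) ?_ ?_ ?_
  · -- `ι⁻¹ V ≠ ∅` because `V` meets `Z = ι(Z_red)`
    obtain ⟨s, hsV, hsZ⟩ := hV
    rw [← hrange] at hsZ
    obtain ⟨w, rfl⟩ := hsZ
    exact ⟨w, hsV⟩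
  · intro w hw hwcl
    rw [preimage_singleton_eq_of_comp_eq ψ I.subschemeι φ hφ w]
    exact hfin _ hw (hwZ w) (hcl w hwcl)
  · intro w hw hwcl
    rw [preimage_singleton_eq_of_comp_eq ψ I.subschemeι φ hφ w]
    exact hne _ hw (hwZ w) (hcl w hwcl)

/-- The image of a morphism from an irreducible scheme is irreducible (for `ψ` universally closed it is moreover closed:
Mathlib `Scheme.Hom.isClosedMap`). [folklore] -/
private theorem isIrreducible_range [IrreducibleSpace T] : IsIrreducible (Set.range ψ.base) := by
  simpa only [Set.image_univ] using
    (IrreducibleSpace.isIrreducible_univ (T : Type u)).image ψ.base ψ.continuous.continuousOn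

/-- **IMAGE EDITION: a proper morphism from an integral scheme with finite general fibres is an alteration onto its image.**
For `ψ : T → S` proper, `T` integral, `S` Jacobson, and an open `V ⊆ S` meeting `ψ(T)` over whose closed points in `ψ(T)` the
fibres of `ψ` are finite, `ψ` lifts to an alteration `φ : T → ψ(T)_red` (reduced structure on the closed irreducible image;
non-emptiness of the fibres over the image is automatic). [cite: DeJong1996, 2.20, p. 61]
[cite: Hartshorne1977, II Example 3.2.6 and Ex. 3.11 (d)] -/
theorem exists_isAlteration_lift_range_of_finite_preimage_of_isClosed [IsIntegral T] [IsProper ψ] [JacobsonSpace S]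
    (V : S.Opens) (hV : ((V : Set S) ∩ Set.range ψ.base).Nonempty)
    (hfin : ∀ s : S, s ∈ V → s ∈ Set.range ψ.base → IsClosed ({s} : Set S) → (ψ.base ⁻¹' {s}).Finite) :
    ∃ φ : T ⟶ (vanishingIdeal (⟨Set.range ψ.base, ψ.isClosedMap.isClosed_range⟩ : Closeds S)).subscheme,
      φ ≫ (vanishingIdeal (⟨Set.range ψ.base, ψ.isClosedMap.isClosed_range⟩ : Closeds S)).subschemeι = ψ ∧
        IsAlteration φ :=
  exists_isAlteration_lift_of_finite_nonempty_preimage_of_isClosed ψ ⟨Set.range ψ.base, ψ.isClosedMap.isClosed_range⟩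
    (isIrreducible_range ψ) subset_rfl V hV hfin fun s _ hs _ => by
      obtain ⟨t, rfl⟩ := hs
      exact ⟨t, rfl⟩

end Lift

/-! ## §2 Dimension: `dim Z = dim T` (de Jong 2.20: an alteration does not change the dimension) -/

section Dimension

variable {k : Type u} [Field k]

/-- **`dim Z = dim T` when `T → Z_red` is an alteration** (`S` locally of finite type over a field `k`, `Z ⊆ S` closed
irreducible): ★ de Jong 2.20 `IsAlteration.topologicalKrullDim_eq` on `Z_red`, which is homeomorphic to `Z`.
[cite: DeJong1996, 2.20, p. 61] -/
theorem topologicalKrullDim_coe_eq_of_isAlteration_lift (f : S ⟶ Spec (.of k)) [LocallyOfFiniteType f] (Z : Closeds S)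
    (hZ : IsIrreducible (Z : Set S))
    {φ : T ⟶ (vanishingIdeal Z).subscheme} (hφ : IsAlteration φ) :
    topologicalKrullDim (Z : Set S) = topologicalKrullDim T := by
  haveI : IsIntegral (vanishingIdeal Z).subscheme := isIntegral_subscheme_vanishingIdeal Z hZ
  haveI : LocallyOfFiniteType ((vanishingIdeal Z).subschemeι ≫ f) := inferInstance
  have h1 := hφ.topologicalKrullDim_eq ((vanishingIdeal Z).subschemeι ≫ f)
  have hrange : Set.range (vanishingIdeal Z).subschemeι.base = (Z : Set S) := range_subschemeι_vanishingIdeal Z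
  let e : ((vanishingIdeal Z).subscheme : Type u) ≃ₜ (Z : Set S) :=
    (vanishingIdeal Z).subschemeι.isClosedEmbedding.isEmbedding.toHomeomorph.trans (Homeomorph.setCongr hrange)
  rw [h1]
  exact (IsHomeomorph.topologicalKrullDim_eq e e.isHomeomorph).symm

/-- **`dim Z = dim T` for a proper `ψ : T → S` (`T` integral, `S` locally of finite type over a field) with finite non-empty
fibres over the closed points of `V ∩ Z ≠ ∅`, `Z ⊇ ψ(T)` closed irreducible** (§1 + de Jong 2.20).
[cite: DeJong1996, 2.20, p. 61] -/
theorem topologicalKrullDim_coe_eq_of_finite_nonempty_preimage_of_isClosed (f : S ⟶ Spec (.of k))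
    [LocallyOfFiniteType f] [IsIntegral T] [IsProper ψ] (Z : Closeds S) (hZ : IsIrreducible (Z : Set S)) (hψZ : Set.range ψ.base ⊆ (Z : Set S))
    (V : S.Opens) (hV : ((V : Set S) ∩ Z).Nonempty)
    (hfin : ∀ s : S, s ∈ V → s ∈ (Z : Set S) → IsClosed ({s} : Set S) → (ψ.base ⁻¹' {s}).Finite)
    (hne : ∀ s : S, s ∈ V → s ∈ (Z : Set S) → IsClosed ({s} : Set S) → (ψ.base ⁻¹' {s}).Nonempty) :
    topologicalKrullDim (Z : Set S) = topologicalKrullDim T := by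
  haveI : JacobsonSpace S := LocallyOfFiniteType.jacobsonSpace f
  obtain ⟨φ, -, hφ⟩ := exists_isAlteration_lift_of_finite_nonempty_preimage_of_isClosed ψ Z hZ hψZ V hV hfin hne
  exact topologicalKrullDim_coe_eq_of_isAlteration_lift f Z hZ hφ

/-- **`dim ψ(T) = dim T` for a proper `ψ : T → S` from an integral scheme with finite fibres over the closed points of an open
meeting the image** (`S` locally of finite type over a field): «generically finite onto its image ⇒ same dimension».
[cite: DeJong1996, 2.20, p. 61] -/
theorem topologicalKrullDim_range_eq_of_finite_preimage_of_isClosed (f : S ⟶ Spec (.of k))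
    [LocallyOfFiniteType f] [IsIntegral T] [IsProper ψ] (V : S.Opens) (hV : ((V : Set S) ∩ Set.range ψ.base).Nonempty)
    (hfin : ∀ s : S, s ∈ V → s ∈ Set.range ψ.base → IsClosed ({s} : Set S) → (ψ.base ⁻¹' {s}).Finite) :
    topologicalKrullDim (Set.range ψ.base) = topologicalKrullDim T := by
  haveI : JacobsonSpace S := LocallyOfFiniteType.jacobsonSpace f
  obtain ⟨φ, -, hφ⟩ := exists_isAlteration_lift_range_of_finite_preimage_of_isClosed ψ V hV hfin
  exact topologicalKrullDim_coe_eq_of_isAlteration_lift f ⟨Set.range ψ.base, ψ.isClosedMap.isClosed_range⟩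
    (isIrreducible_range ψ) hφ

end Dimension

end Literature.AlgebraicGeometry.Morphisms

/-! ## §3 The `k`-point currency (`k` algebraically closed; `X`, `Y` locally of finite type over `k`) -/

namespace Literature.AlgebraicGeometry.Motives

namespace AlgPoints

open Scheme.IdealSheafData Literature.AlgebraicGeometry.Resolution

variable {k : Type u} [Field k] [IsAlgClosed k] {X Y : SchemeOver k}

/-- **A `k`-point of `Y` lying in the image of `α : X → Y` is the image of a `k`-point of `X`** (`k` algebraically closed,
`X`, `Y` locally of finite type): the fibre over it is a non-empty closed subset of the Jacobson space `X`, so it contains a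
closed point, which is `k`-rational (Nullstellensatz).  The `ℂ`-point case is ★
`HodgeTheory.AlgPoints.exists_map_eq_of_pt_mem_range` (`GysinKernelSplitProofs`); same argument for any algebraically closed `k`.
[cite: GortzWedhorn2020, Prop. 3.35 and Section (3.13)] [cite: Hartshorne1977, II Ex. 2.7 and Ex. 3.14] -/
theorem exists_map_eq_of_pt_mem_range [LocallyOfFiniteType X.hom] [LocallyOfFiniteType Y.hom] (α : X ⟶ Y)
    (a : AlgPoints Y k) (ha : a.pt ∈ Set.range α.left.base) : ∃ z : AlgPoints X k, map α z = a := by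
  haveI : JacobsonSpace X.left := LocallyOfFiniteType.jacobsonSpace X.hom
  obtain ⟨x, hx⟩ := ha
  have hcl : IsClosed (α.left.base ⁻¹' {a.pt}) := a.isClosed_singleton_pt.preimage α.left.continuous
  obtain ⟨x₀, hx₀, hx₀cl⟩ := nonempty_inter_closedPoints ⟨x, hx⟩ hcl.isLocallyClosed
  obtain ⟨z, hz⟩ := AlgPoints.exists_pt_eq_of_isClosed_singleton (X := X) (mem_closedPoints_iff.mp hx₀cl)
  refine ⟨z, AlgPoints.eq_of_pt_eq (X := Y) ?_⟩
  rw [pt_map, hz]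
  exact hx₀

/-- **A proper `k`-morphism with finite non-empty `k`-point fibres over the `k`-points of `V ∩ Z`, lifted to a closed irreducible
`Z ⊇ α(X)`, is an ALTERATION onto `Z`** (`k` algebraically closed; `X` integral, `X`, `Y` locally of finite type over `k`;
`V ⊆ Y` open with `V ∩ Z ≠ ∅`): `α` factors as `φ ≫ ι_Z` through the reduced structure `Z_red` and `φ` is an alteration —
§1 with the fibre hypotheses converted by ★ `finite_preimage_pt` ∕ `nonempty_preimage_pt` (the closed points of `Y` are the
`k`-points). [cite: DeJong1996, 2.20, p. 61] [cite: GortzWedhorn2020, Prop. 3.35] [cite: Hartshorne1977, II Example 3.2.6] -/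
theorem exists_isAlteration_lift_of_finite_nonempty_fibres [LocallyOfFiniteType X.hom] [LocallyOfFiniteType Y.hom]
    [IsIntegral X.left] (α : X ⟶ Y) [IsProper α.left] (Z : Closeds Y.left) (hZ : IsIrreducible (Z : Set Y.left))
    (hαZ : Set.range α.left.base ⊆ (Z : Set Y.left)) (V : Y.left.Opens) (hV : ((V : Set Y.left) ∩ Z).Nonempty)
    (hfin : ∀ a : AlgPoints Y k, a.pt ∈ V → a.pt ∈ (Z : Set Y.left) → {z : AlgPoints X k | map α z = a}.Finite)
    (hne : ∀ a : AlgPoints Y k, a.pt ∈ V → a.pt ∈ (Z : Set Y.left) → {z : AlgPoints X k | map α z = a}.Nonempty) :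
    ∃ φ : X.left ⟶ (vanishingIdeal Z).subscheme,
      φ ≫ (vanishingIdeal Z).subschemeι = α.left ∧ IsAlteration φ := by
  haveI : JacobsonSpace Y.left := LocallyOfFiniteType.jacobsonSpace Y.hom
  refine Morphisms.exists_isAlteration_lift_of_finite_nonempty_preimage_of_isClosed α.left Z hZ hαZ V hV ?_ ?_
  · intro s hsV hsZ hcl
    obtain ⟨a, rfl⟩ := AlgPoints.exists_pt_eq_of_isClosed_singleton (X := Y) hcl
    exact finite_preimage_pt α a (hfin a hsV hsZ)
  · intro s hsV hsZ hcl
    obtain ⟨a, rfl⟩ := AlgPoints.exists_pt_eq_of_isClosed_singleton (X := Y) hcl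
    exact nonempty_preimage_pt α a (hne a hsV hsZ)

/-- **IMAGE EDITION in the `k`-point currency: a proper `k`-morphism from an integral `X` with finitely many `k`-points over the
`k`-points of an open `V` meeting `α(X)` is an alteration onto its image** (reduced structure on the closed irreducible `α(X)`;
the finiteness hypothesis is asked only at `k`-points `a` that ARE images of `k`-points of `X`).
[cite: DeJong1996, 2.20, p. 61] [cite: GortzWedhorn2020, Prop. 3.35] [cite: Hartshorne1977, II Ex. 3.11 (d)] -/
theorem exists_isAlteration_lift_range_of_finite_fibres [LocallyOfFiniteType X.hom] [LocallyOfFiniteType Y.hom]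
    [IsIntegral X.left] (α : X ⟶ Y) [IsProper α.left] (V : Y.left.Opens)
    (hV : ((V : Set Y.left) ∩ Set.range α.left.base).Nonempty)
    (hfin : ∀ a : AlgPoints Y k, a.pt ∈ V → (∃ z : AlgPoints X k, map α z = a) →
      {z : AlgPoints X k | map α z = a}.Finite) :
    ∃ φ : X.left ⟶ (vanishingIdeal (⟨Set.range α.left.base, α.left.isClosedMap.isClosed_range⟩ : Closeds Y.left)).subscheme,
      φ ≫ (vanishingIdeal (⟨Set.range α.left.base, α.left.isClosedMap.isClosed_range⟩ : Closeds Y.left)).subschemeι = α.left ∧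
        IsAlteration φ := by
  haveI : JacobsonSpace Y.left := LocallyOfFiniteType.jacobsonSpace Y.hom
  refine Morphisms.exists_isAlteration_lift_range_of_finite_preimage_of_isClosed α.left V hV ?_
  intro s hsV hs hcl
  obtain ⟨a, rfl⟩ := AlgPoints.exists_pt_eq_of_isClosed_singleton (X := Y) hcl
  exact finite_preimage_pt α a (hfin a hsV (exists_map_eq_of_pt_mem_range α a hs))

/-- **`dim Z = dim X`** under the hypotheses of `exists_isAlteration_lift_of_finite_nonempty_fibres` (§2 over `Spec k`).
[cite: DeJong1996, 2.20, p. 61] [cite: GortzWedhorn2020, Prop. 3.35] -/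
theorem topologicalKrullDim_coe_eq_of_finite_nonempty_fibres [LocallyOfFiniteType X.hom] [LocallyOfFiniteType Y.hom]
    [IsIntegral X.left] (α : X ⟶ Y) [IsProper α.left] (Z : Closeds Y.left) (hZ : IsIrreducible (Z : Set Y.left))
    (hαZ : Set.range α.left.base ⊆ (Z : Set Y.left)) (V : Y.left.Opens) (hV : ((V : Set Y.left) ∩ Z).Nonempty)
    (hfin : ∀ a : AlgPoints Y k, a.pt ∈ V → a.pt ∈ (Z : Set Y.left) → {z : AlgPoints X k | map α z = a}.Finite)
    (hne : ∀ a : AlgPoints Y k, a.pt ∈ V → a.pt ∈ (Z : Set Y.left) → {z : AlgPoints X k | map α z = a}.Nonempty) :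
    topologicalKrullDim (Z : Set Y.left) = topologicalKrullDim X.left := by
  obtain ⟨φ, -, hφ⟩ := exists_isAlteration_lift_of_finite_nonempty_fibres α Z hZ hαZ V hV hfin hne
  exact Morphisms.topologicalKrullDim_coe_eq_of_isAlteration_lift Y.hom Z hZ hφ

/-- **`dim α(X) = dim X`** for a proper `k`-morphism from an integral `X` with finitely many `k`-points over the `k`-points of an
open meeting the image: «generically finite ⇒ the image has the same dimension». [cite: DeJong1996, 2.20, p. 61]
[cite: GortzWedhorn2020, Prop. 3.35] -/
theorem topologicalKrullDim_range_eq_of_finite_fibres [LocallyOfFiniteType X.hom] [LocallyOfFiniteType Y.hom]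
    [IsIntegral X.left] (α : X ⟶ Y) [IsProper α.left] (V : Y.left.Opens)
    (hV : ((V : Set Y.left) ∩ Set.range α.left.base).Nonempty)
    (hfin : ∀ a : AlgPoints Y k, a.pt ∈ V → (∃ z : AlgPoints X k, map α z = a) →
      {z : AlgPoints X k | map α z = a}.Finite) :
    topologicalKrullDim (Set.range α.left.base) = topologicalKrullDim X.left := by
  obtain ⟨φ, -, hφ⟩ := exists_isAlteration_lift_range_of_finite_fibres α V hV hfin
  exact Morphisms.topologicalKrullDim_coe_eq_of_isAlteration_lift Y.hom
    ⟨Set.range α.left.base, α.left.isClosedMap.isClosed_range⟩ (Morphisms.isIrreducible_range α.left) hφ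

end AlgPoints

end Literature.AlgebraicGeometry.Motives

end
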